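import Literature.Computability.Cryptography.ShorOrderFindingQuantum
import HarnessLib

/-!
# Shor's discrete-logarithm theorem, quantum half: Kitaev's two-generator experiment and the assembly

Family `PQC` (trunk `CryptoQuantFine`); companion of `Literature/Computability/Cryptography/Shor.lean`
for the named fact `Literature.Computability.Cryptography.isQSolvable_dlog` (Shor 1997, §6: discrete logarithms modulo a prime
with a given primitive root are computable in bounded-error quantum polynomial time, FBQP form
over the tree's model — poly-time uniform oracle-free Clifford+T families measured on all wires,
`IsQSolvable`).

Shor's printed route (§6, pp. 16–18 of arXiv:quant-ph/9508027v2: two registers uniform modulo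
`p - 1`, `g^a x^{-b} mod p` in a third, the transform `A_q` with `p < q < 2p` on both, "good"
outputs (6.11)–(6.12) of probability `≥ 1/480`, recovery of `r` from `t` good `c'`) uses the
controlled phases `π/2^{k-j}` of `A_q` (§4), which are not exact circuits over `{H, S, T, CNOT}`
(Giles–Selinger 2013, Thm. 1). As for order finding (`ShorOrderFindingQuantum`), the exact route
formalised here is Kitaev's (1995): the discrete logarithm is Kitaev's Abelian stabilizer problem
with `k = 2` generators (§1, p. 5: "the stabilizer of `1` with respect to `F_{ζ,g}` is
`P = {(m, r) : ζ^m g^r = 1}` … find an element of the form `(m, -1) ∈ P`, then `ζ^m = g`"), solved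
by eigenvalue measurements (§3: Hadamard tests of controlled powers, `S³` for the sine tests) of
the *two commuting permutations* "multiply by `g`" and "multiply by `y`" on shared target
registers (§4, p. 15). This file fixes that experiment, proves its analysis end to end on top of
the Kitaev infrastructure of the order-finding files, and assembles `isQSolvable_dlog` from three
named infrastructure facts — the same three kinds as for order finding:

* **Weighted outcome law** (`trialExpW`, `testAngleW`, `sum_prod_mul_exp_eq_prodW`,
  `kitaevCircuit_distributionW`): the read-out law of `kitaevCircuit` when control `j` carries an
  arbitrary weight `w_j` in the exponent (here `2^l` for a `g`-test and `a·2^l` for a `y`-test,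
  `a` the discrete logarithm), generalising `kitaevCircuit_distribution` (`w_j = 2^{e_j}`).
* **Parameters and layout** (`dlNumLevels ℓ = ℓ+1`, `dlBlockSize ℓ = 12288(ℓ+1)`, `dlNumControls`,
  `dlLayout`, `dlTrialOf`/`dlGenOf`/`dlLevelOf`/`dlTypeOf`, `dlBlock`, `card_dlBlock`): four trials
  (target registers); in trial `t`, for each generator (`g` or `y`) and every level `l ≤ ℓ`,
  `dlBlockSize ℓ` cosine tests and as many sine tests of the `2^l`-th power.
* **Post-processing** (`dlCnt`, `dlLevelEst`, `dlPhaseEst`, `roundMul`, `solveStep`, `solveCongr`,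
  `dlogEst`, `dlReadControls`, `dlogPost`): counts per block, quadrant centres, halving refinement
  over `ℚ` (`refined`, `KitaevPhaseReconstruction`), rounding to the nearest multiple of
  `1/(p-1)` (the denominator is *known*, so no continued fractions are needed), and the solution
  of the linear congruences `s_t · a ≡ c_t (mod p-1)` by iterated Bézout / extended Euclid.
* **Correctness on accurate read-outs** (`DlAccurate`, `cdist_dlLevelEst_le`, `cdist_dlPhaseEst_le`,
  `roundMul_eq_mod`, `solveCongr_eq`, `dlogEst_eq`): if every block count is within `B/16` of its
  mean under the hidden sample `s ∈ (ℤ/(p-1))^4` and the `s_t` have no common divisor `≥ 2` with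
  `p - 1` (`Good`), the phases `s_t/(p-1)` and `a s_t/(p-1)` are estimated within `(5/32)/2^ℓ <
  1/(2(p-1))`, rounding returns `s_t` and `a s_t mod (p-1)`, and the congruence solver returns `a`.
* **Probability** (`sum_not_dlAccurate_le`, `sum_dlAccurate_ge`, `dlog_success`: with the weighted
  read-out law the favourable read-outs have Born probability `≥ (7/8)(11/12) = 77/96`, reusing
  `card_good_ge` and `chebyshev_block`), and the Born-rule plumbing to `QCircuitFamily.kernelProb`
  (`kernelProb_dlogPost_ge`).
* **Named facts** (infrastructure, not discharged here): `Kitaev1995_dlogFamily` — the Kitaev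
  family around a *clean reversible block computing the four products `g^{A_t(c)} y^{B_t(c)} mod p`*
  exists and is poly-time uniform (Shor 1997, §3 p. 8 and §6 p. 16 "compute `g^a x^{-b} mod p` in
  the third register"; Kitaev 1995, §2.2 Lemma 1, §4 p. 15 "our procedure is uniform"; needs the
  tree's pending TM-to-reversible-circuit compiler); `dlogPost_mem_FP` — the post-processor is
  polynomial time (programming fact).
* **Assembly**: `isQSolvable_dlog_of : isQSolvable_classicalWrap → Kitaev1995_dlogFamily →
  dlogPost_mem_FP → isQSolvable_dlog`.

## References

* P. W. Shor, *Polynomial-time algorithms for prime factorization and discrete logarithms on a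
  quantum computer*, SIAM J. Comput. 26 (1997) 1484–1509 (= arXiv:quant-ph/9508027v2), §6
  (discrete logarithms, pp. 16–18), §3 (reversible modular exponentiation, pp. 8–10), §2 (p. 7,
  uniform gate arrays), §4 (p. 11, `A_q` from `R_j` and `S_{j,k}`).
* A. Yu. Kitaev, *Quantum measurements and the Abelian Stabilizer Problem*,
  arXiv:quant-ph/9511026 (1995): §1 p. 5 (the discrete logarithm as an ASP with two generators),
  §2.2 Lemma 1 (garbage-free `(u,0,0) ↦ (u,F(u),0)`), §3 Remark 8, Lemma 8, Lemma 10, Theorem 1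
  (pp. 13–14), §4 (p. 15: random elements of `H`, several registers, uniformity).
* B. Giles, P. Selinger, *Exact synthesis of multiqubit Clifford+T circuits*, Phys. Rev. A 87
  (2013) 032332, Thm. 1.
* E. Bernstein, U. Vazirani, *Quantum complexity theory*, SIAM J. Comput. 26 (1997), §8.

## Tree

`isQSolvable_dlog`, `IsDLogInstance`, `dlogSolutions`, `encodeDLogInstance` (`Shor`);
`existsUnique_mem_dlogSolutions_holds`, `isQSolvable_classicalWrap`, `IsQSolvable.mono`
(`ShorProofs`); `kitaevCircuit`, `kitaevCircuit_runOn_tri`, `tri`, `triEquiv`, `testWeight`,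
`trialExp`, `sPhase_mul_ySign`, `invSqrt2_pow_mul_pow` (`KitaevPhaseEstimationCircuit`);
`parseval_fibers`, `sum_pi_bool_prod`, `norm_sq_testAmplitude`, `chebyshev_block`, `sum_prodWeight`
(`KitaevPhaseEstimationSums`); `cdist`, `refined`, `cdist_refined_le`, `quadrantCenter`,
`exists_cdist_eq` (`KitaevPhaseReconstruction`); `numTrials`, `Good`, `card_good_ge`,
`trigEst_of_cnt`, `cdist_quadrantCenter_le_bool`, `testWeight_nonneg`, `testWeight_false_add_true`,
`sum_filter_exists_le`, `toReal_outputPMF_map_toOuterMeasure`, `sum_tri_le_sum_ite`,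
`kernelProb_univ` (`ShorOrderFindingQuantum`); `coinWire`, `coinInput`, `val_coinWire`
(`BQPProofs`); `boolPair`, `boolUnpair`, `bitsToNat_lt`, `length_boolPair` (`BoolEncodings`);
Mathlib `Nat.gcdA`, `Nat.gcdB`, `Nat.gcd_eq_gcd_ab`, `round`, `Int.floor_eq_iff`.

## Design choices

* Nothing in `Shor.lean` is restated or weakened; the assembly theorem takes the named facts as
  hypotheses `(h : X)` (tree convention, cf. `Shor1997_orderFinding_isQSolvable_of`).
* The `y`-tests of trial `t` measure the eigenphase `a s_t/(p-1)` of "multiply by `y = g^a`" on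
  the *same* target register as the `g`-tests (eigenphase `s_t/(p-1)`): this is why the weighted
  law is needed (one hidden `s_t` per trial, weights `2^l` and `a 2^l`), and why the discrete
  logarithm is read off linear congruences rather than by a division by a possibly non-invertible
  `s_t` (Shor's difficulty with `c'`, §6 p. 17): four samples generate `ℤ/(p-1)` with probability
  `≥ 7/8` (`card_good_ge`), and then iterated Bézout solves for `a` exactly.
* `dlNumLevels ℓ = ℓ + 1` levels give precision `(5/32)/2^ℓ < 1/(2(p-1))` since `p < 2^ℓ` for an
  instance of encoded length `ℓ`; the trivial instance `p = 2` (`p - 1 = 1`, `a = 0`) is covered by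
  the same argument.
-/

noncomputable section

namespace Literature.Computability.Cryptography

namespace Kitaev1995

open _root_.Computability Complexity QuantumComplexity Matrix Finset Real

/-! ### The weighted outcome law of Kitaev's circuit -/

section weighted

open Complex

variable {n k m : ℕ}

/-- The weighted exponent carried by the controls of trial `t`: `E_t(y) = ∑_{j : τ j = t} y_j w_j`
(for `w_j = 2^{e_j}` this is `trialExp`; for the discrete logarithm the `y`-tests carry
`w_j = a 2^{e_j}`). [cite: Kitaev1995, §3 (Lemma 10) and §4 (two generators V_1, V_2)] -/
def trialExpW {T : Type*} [DecidableEq T] (τ : Fin k → T) (w : Fin k → ℕ) (t : T) (y : QReg k) : ℕ :=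
  ∑ j ∈ univ.filter (fun j => τ j = t), (y j).toNat * w j

/-- With the weights `w_j = 2^{e_j}` the weighted exponent is the exponent `trialExp` of the
order-finding experiment. [folklore] -/
theorem trialExpW_two_pow {T : Type*} [DecidableEq T] (τ : Fin k → T) (e : Fin k → ℕ) (t : T)
    (y : QReg k) : trialExpW τ (fun j => 2 ^ e j) t y = trialExp τ e t y := rfl

/-- The weighted test angle of control `j` under the eigenvalue index `s`: `2π s_{τ j} w_j / r`.
[cite: Kitaev1995, §3 (Lemma 10) and §4] -/
def testAngleW {T : Type*} (r : ℕ) (τ : Fin k → T) (w : Fin k → ℕ) (s : T → Fin r)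
    (j : Fin k) : ℝ :=
  2 * Real.pi * ((s (τ j) : ℕ) : ℝ) * (w j : ℝ) / r

/-- Regrouping the weighted exponent by controls: `∑_t s_t E_t(c) = ∑_j s_{τ j} c_j w_j`.
[folklore] -/
theorem sum_trialExponentW_eq {J T : Type*} [Fintype J] [Fintype T] [DecidableEq T]
    (τ : J → T) (w : J → ℕ) (s : T → ℂ) (c : J → Bool) :
    (∑ t, s t * ∑ j ∈ univ.filter (fun j => τ j = t), (((c j).toNat * w j : ℕ) : ℂ)) =
      ∑ j, s (τ j) * (((c j).toNat * w j : ℕ) : ℂ) := by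
  simp_rw [mul_sum]
  rw [show (∑ t, ∑ j ∈ univ.filter (fun j => τ j = t), s t * (((c j).toNat * w j : ℕ) : ℂ)) =
      ∑ t, ∑ j ∈ univ.filter (fun j => τ j = t), s (τ j) * (((c j).toNat * w j : ℕ) : ℂ) from
    sum_congr rfl fun t _ => sum_congr rfl fun j hj => by rw [(mem_filter.1 hj).2]]
  exact sum_fiberwise univ τ _

/-- **Factorisation of the weighted Kitaev amplitude** over the independent control bits:
`∑_c (∏_j χ_j(c_j)) e^{2πi ∑_t s_t E_t(c)/r} = ∏_j (χ_j(0) + χ_j(1) e^{2πi s_{τ j} w_j / r})`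
(Kitaev 1995, §3, Lemma 8 (3): measurements with disjoint additional registers multiply).
[cite: Kitaev1995, §3 Lemma 8] -/
theorem sum_prod_mul_exp_eq_prodW {J T : Type*} [Fintype J] [DecidableEq J] [Fintype T]
    [DecidableEq T] (r : ℕ) (τ : J → T) (w : J → ℕ) (χ : J → Bool → ℂ) (s : T → ℂ) :
    ∑ c : J → Bool, (∏ j, χ j (c j)) *
        cexp (2 * π * I * ((∑ t, s t * ∑ j ∈ univ.filter (fun j => τ j = t),
          (((c j).toNat * w j : ℕ) : ℂ)) / r)) =
      ∏ j, (χ j false + χ j true * cexp (2 * π * I * (s (τ j) * (w j : ℂ) / r))) := by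
  have hterm : ∀ c : J → Bool, (∏ j, χ j (c j)) *
      cexp (2 * π * I * ((∑ t, s t * ∑ j ∈ univ.filter (fun j => τ j = t),
        (((c j).toNat * w j : ℕ) : ℂ)) / r)) =
      ∏ j, χ j (c j) * cexp (2 * π * I * (s (τ j) * (((c j).toNat * w j : ℕ) : ℂ) / r)) := by
    intro c
    rw [sum_trialExponentW_eq, sum_div, mul_sum, Complex.exp_sum, ← prod_mul_distrib]
  rw [sum_congr rfl fun c _ => hterm c, sum_pi_bool_prod fun j b =>
    χ j b * cexp (2 * π * I * (s (τ j) * ((b.toNat * w j : ℕ) : ℂ) / r))]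
  refine prod_congr rfl fun j _ => ?_
  simp only [Bool.toNat_false, Bool.toNat_true, zero_mul, one_mul, Nat.cast_zero,
    mul_zero, zero_div, Complex.exp_zero, mul_one]

/-- **The weighted outcome law of Kitaev's circuit** (Kitaev 1995, §3 Remark 8 and Lemma 8; §4,
p. 15: for the state `|a⟩ = q^{-1/2} ∑_h |ψ_h⟩`, `P(h) = q⁻¹ ∑_{h'} P(h', h)`, here with several
commuting permutations tested on the same register). If the classical block writes a
work-register content `R y` separating exactly the residues modulo `r` of the weighted trial
exponents `E_t(y) = ∑_{τ j = t} y_j w_j`, then the control read-out `γ` has Born probability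
`P(γ) = r^{-K} ∑_{s ∈ (ℤ/r)^K} ∏_j testWeight γ_j σ_j (2π s_{τ j} w_j / r)`.
[cite: Kitaev1995, §3 (Remark 8, Lemma 8) and §4 (P(h) = q^{-1} sum_{h'} P(h',h))] -/
theorem kitaevCircuit_distributionW (V : QCircuit cliffordT (n + (k + m))) (σ : Fin k → Bool)
    (x : QReg n) (R : QReg k → QReg m)
    (hV : ∀ y : QReg k, V.toMatrix 0 *ᵥ basisState (coinInput x y) = basisState (tri x y (R y)))
    {T : Type*} [Fintype T] [DecidableEq T] {r : ℕ} (hr : 0 < r) (τ : Fin k → T) (w : Fin k → ℕ)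
    (hR : ∀ y y' : QReg k, R y = R y' ↔
      ∀ t, (r : ℤ) ∣ (trialExpW τ w t y : ℤ) - (trialExpW τ w t y' : ℤ))
    (γ : QReg k) :
    ∑ ρ : QReg m, ‖(kitaevCircuit V σ).runOn 0 (basisState (padInput x (k + m))) (tri x γ ρ)‖ ^ 2
      = (1 / (r : ℝ) ^ Fintype.card T) *
          ∑ s : T → Fin r, ∏ j, testWeight (γ j) (σ j) (testAngleW r τ w s j) := by
  classical
  -- the amplitudes as fibrewise sums of `φ`
  set χ : Fin k → Bool → ℂ := fun j b =>
    if b then (if γ j then (-1 : ℂ) else 1) * (if σ j then -I else 1) else 1 with hχ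
  set φ : QReg k → ℂ := fun y => (1 / 2 : ℂ) ^ k * ∏ j, χ j (y j) with hφ
  have hamp : ∀ ρ : QReg m,
      (kitaevCircuit V σ).runOn 0 (basisState (padInput x (k + m))) (tri x γ ρ) =
        ∑ y ∈ univ.filter (fun y => R y = ρ), φ y := by
    intro ρ
    rw [kitaevCircuit_runOn_tri V σ x R hV, invSqrt2_pow_mul_pow, mul_sum]
    refine sum_congr rfl fun y _ => ?_
    rw [hφ, sPhase_mul_ySign]
  simp_rw [hamp]
  -- Parseval over `(ℤ/r)^K`
  rw [parseval_fibers hr (fun t y => (trialExpW τ w t y : ℤ)) R hR φ]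
  refine congrArg (fun u : ℝ => (1 / (r : ℝ) ^ Fintype.card T) * u) ?_
  refine Finset.sum_congr rfl fun s _ => ?_
  -- factorisation of the character sum
  have hfac : ∑ y : QReg k, φ y * cexp (2 * Real.pi * I *
      ((∑ t, ((s t : ℕ) : ℂ) * ((trialExpW τ w t y : ℤ) : ℂ)) / r)) =
      ∏ j, (1 + χ j true * cexp (2 * Real.pi * I * (((s (τ j) : ℕ) : ℂ) * (w j : ℂ) / r))) / 2 := by
    have h1 : ∀ y : QReg k, φ y * cexp (2 * Real.pi * I *
        ((∑ t, ((s t : ℕ) : ℂ) * ((trialExpW τ w t y : ℤ) : ℂ)) / r)) =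
        (1 / 2 : ℂ) ^ k * ((∏ j, χ j (y j)) * cexp (2 * Real.pi * I *
          ((∑ t, ((s t : ℕ) : ℂ) * ∑ j ∈ univ.filter (fun j => τ j = t),
            (((y j).toNat * w j : ℕ) : ℂ)) / r))) := by
      intro y
      rw [hφ, mul_assoc]
      congr 3
      push_cast [trialExpW]
      rfl
    rw [sum_congr rfl fun y _ => h1 y, ← mul_sum,
      sum_prod_mul_exp_eq_prodW r τ w χ fun t => ((s t : ℕ) : ℂ), prod_div_distrib,
      prod_const, card_univ, Fintype.card_fin]
    have hχ0 : ∀ j, χ j false = 1 := fun j => by simp [hχ]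
    simp_rw [hχ0]
    rw [one_div, inv_pow, ← div_eq_inv_mul]
  rw [hfac, norm_prod, ← prod_pow]
  refine prod_congr rfl fun j _ => ?_
  -- the single-test probability
  have := norm_sq_testAmplitude (γ j) (σ j) (testAngleW r τ w s j)
  rw [testWeight, ← this, hχ]
  congr 3
  simp only [if_true]
  rw [testAngleW]
  push_cast
  ring_nf

end weighted

/-! ### Parameters of the discrete-logarithm experiment (functions of the input length `ℓ`) -/

/-- Number of levels: the powers `U^{2^l}`, `l ≤ ℓ`, are tested. The denominator `p - 1 < 2^ℓ`
is known, so precision `< 1/(2(p-1))` — reached with `ℓ + 1` levels — suffices to round to the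
exact phase (cf. Kitaev 1995, Thm. 1, where an unknown denominator needs `2n + 1` levels and
continued fractions). [cite: Kitaev1995, §3 Lemma 10 and Thm 1] -/
def dlNumLevels (ℓ : ℕ) : ℕ := ℓ + 1

/-- Number of repetitions of each Hadamard test (cosine and sine, per trial, generator and
level); chosen so that Chebyshev's inequality bounds the total failure probability of the
`2 · 2 · 4 · (ℓ+1)` estimates by `1/12`. [cite: Kitaev1995, §3 (before Lemma 9)] -/
def dlBlockSize (ℓ : ℕ) : ℕ := 12288 * dlNumLevels ℓ

/-- Number of control wires: one per test (`trial × generator × level × type × repetition`).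
[folklore] -/
def dlNumControls (ℓ : ℕ) : ℕ := numTrials * (2 * (dlNumLevels ℓ * (2 * dlBlockSize ℓ)))

/-- Test labels `(trial, generator, level, type, repetition)`; generator `false` = the primitive
root `g`, `true` = the element `y`; type `false` = cosine test, `true` = sine test. [folklore] -/
abbrev DlTestLabel (ℓ : ℕ) :=
  Fin numTrials × Bool × Fin (dlNumLevels ℓ) × Bool × Fin (dlBlockSize ℓ)

/-- Block labels `(trial, generator, level, type)`. [folklore] -/
abbrev DlBlk (ℓ : ℕ) := Fin numTrials × Bool × Fin (dlNumLevels ℓ) × Bool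

/-- The layout of the control wires: control `j` carries the test `dlLayout ℓ j` (mixed-radix
digits of `j`). [folklore] -/
def dlLayout (ℓ : ℕ) : Fin (dlNumControls ℓ) ≃ DlTestLabel ℓ :=
  finProdFinEquiv.symm.trans <| Equiv.prodCongr (Equiv.refl _) <|
    finProdFinEquiv.symm.trans <| Equiv.prodCongr finTwoEquiv <|
      finProdFinEquiv.symm.trans <| Equiv.prodCongr (Equiv.refl _) <|
        finProdFinEquiv.symm.trans <| Equiv.prodCongr finTwoEquiv (Equiv.refl _)

/-- The trial (target register) of control `j`. [folklore] -/
def dlTrialOf (ℓ : ℕ) (j : Fin (dlNumControls ℓ)) : Fin numTrials := (dlLayout ℓ j).1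

/-- The generator tested by control `j` (`false` = `g`, `true` = `y`). [folklore] -/
def dlGenOf (ℓ : ℕ) (j : Fin (dlNumControls ℓ)) : Bool := (dlLayout ℓ j).2.1

/-- The level of control `j` (it controls the `2^level`-th power). [folklore] -/
def dlLevelOf (ℓ : ℕ) (j : Fin (dlNumControls ℓ)) : Fin (dlNumLevels ℓ) := (dlLayout ℓ j).2.2.1

/-- The type of control `j` (`true` = sine test, carrying the `S³` gate). [folklore] -/
def dlTypeOf (ℓ : ℕ) (j : Fin (dlNumControls ℓ)) : Bool := (dlLayout ℓ j).2.2.2.1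

/-- The (trial, generator) tag of control `j`: the controls with tag `(t, false)` carry the
exponent `A_t` of `g`, those with tag `(t, true)` the exponent `B_t` of `y`. [folklore] -/
def dlTag (ℓ : ℕ) (j : Fin (dlNumControls ℓ)) : Fin numTrials × Bool := (dlTrialOf ℓ j, dlGenOf ℓ j)

/-- The exponents `e_j = level j` as natural numbers. [folklore] -/
def dlExps (ℓ : ℕ) (j : Fin (dlNumControls ℓ)) : ℕ := (dlLevelOf ℓ j : ℕ)

/-- The block of control `j`. [folklore] -/
def dlBlkOf (ℓ : ℕ) (j : Fin (dlNumControls ℓ)) : DlBlk ℓ :=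
  (dlTrialOf ℓ j, dlGenOf ℓ j, dlLevelOf ℓ j, dlTypeOf ℓ j)

/-- The controls of a block. [folklore] -/
def dlBlock (ℓ : ℕ) (β : DlBlk ℓ) : Finset (Fin (dlNumControls ℓ)) :=
  univ.filter fun j => dlBlkOf ℓ j = β

/-- A block is the image of the repetitions under the inverse layout. [folklore] -/
theorem dlBlock_eq_image (ℓ : ℕ) (β : DlBlk ℓ) :
    dlBlock ℓ β = univ.image fun i : Fin (dlBlockSize ℓ) =>
      (dlLayout ℓ).symm (β.1, β.2.1, β.2.2.1, β.2.2.2, i) := by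
  ext j
  simp only [dlBlock, mem_filter, mem_univ, true_and, mem_image]
  constructor
  · intro h
    refine ⟨(dlLayout ℓ j).2.2.2.2, ?_⟩
    rw [Equiv.symm_apply_eq, ← h]
    rfl
  · rintro ⟨i, rfl⟩
    simp [dlBlkOf, dlTrialOf, dlGenOf, dlLevelOf, dlTypeOf]

/-- Every block consists of `dlBlockSize ℓ` controls. [folklore] -/
theorem card_dlBlock (ℓ : ℕ) (β : DlBlk ℓ) : (dlBlock ℓ β).card = dlBlockSize ℓ := by
  rw [dlBlock_eq_image, card_image_of_injective _ fun i i' h => by simpa using h]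
  simp

/-! ### The classical post-processing of a control read-out -/

/-- The number of `1`s read in block `β`. [cite: Kitaev1995, §3 (before Lemma 9: "count how many 1's")] -/
def dlCnt {ℓ : ℕ} (β : DlBlk ℓ) (γ : Fin (dlNumControls ℓ) → Bool) : ℕ :=
  ((dlBlock ℓ β).filter fun j => γ j = true).card

/-- The coarse localisation of `2^l φ_{t,η}`: the centre of the quadrant given by the signs of
the estimated cosine `1 - 2·cnt/B` and sine (exact rationals). [cite: Kitaev1995, §3 Lemma 10] -/
def dlLevelEst (ℓ : ℕ) (γ : Fin (dlNumControls ℓ) → Bool) (t : Fin numTrials) (η : Bool)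
    (l : Fin (dlNumLevels ℓ)) : ℚ :=
  quadrantCenter (decide (2 * dlCnt (t, η, l, false) γ ≤ dlBlockSize ℓ))
    (decide (2 * dlCnt (t, η, l, true) γ ≤ dlBlockSize ℓ))

/-- The refined estimate of the phase `φ_{t,η}` (`s_t/(p-1)` for `η = false`,
`a s_t/(p-1)` for `η = true`) of trial `t`, halving from the top level down over `ℚ`.
[cite: Kitaev1995, §3 Lemma 10] -/
def dlPhaseEst (ℓ : ℕ) (γ : Fin (dlNumControls ℓ) → Bool) (t : Fin numTrials) (η : Bool) : ℚ :=
  refined (fun l => if h : l < dlNumLevels ℓ then dlLevelEst ℓ γ t η ⟨l, h⟩ else 0) (dlNumLevels ℓ)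

/-- Rounding a phase estimate to the nearest multiple of `1/M`, as a residue modulo `M`:
`round(φ M) mod M`. (The denominator `M = p - 1` is known; this replaces the continued-fraction
step of Kitaev 1995, Thm. 1.) [folklore] -/
def roundMul (M : ℕ) (φ : ℚ) : ℕ :=
  ((round (φ * M) : ℤ) % (M : ℤ)).toNat

/-- One step of the congruence solver: from `(g, e)` and a pair `(s, c)` to
`(gcd(g, s), e·A + c·B)` where `g·A + s·B = gcd(g, s)` (extended Euclid, Mathlib's
`Nat.gcdA`/`Nat.gcdB`). Invariant: `e ≡ g·a (mod M)` whenever `c ≡ s·a (mod M)`.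
[Knuth, TAOCP vol. 2, §4.5.2 Algorithm X] [folklore] -/
def solveStep (ge : ℕ × ℤ) (sc : ℕ × ℕ) : ℕ × ℤ :=
  (Nat.gcd ge.1 sc.1, ge.2 * Nat.gcdA ge.1 sc.1 + sc.2 * Nat.gcdB ge.1 sc.1)

/-- **Solving the linear congruences `s_i · a ≡ c_i (mod M)`** when `gcd(M, s_1, …, s_K) = 1`:
fold `solveStep` from `(M, 0)`; the final `e` satisfies `e ≡ a (mod M)`, output `e mod M`
(Kitaev 1995, §1 p. 5: from generators of the stabilizer `P = {(m, r) : ζ^m g^r = 1}` "find an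
element of the form `(m, -1)`"). [cite: Kitaev1995, §1 p.5 (discrete logarithm from the stabilizer)] -/
def solveCongr (M : ℕ) (l : List (ℕ × ℕ)) : ℕ :=
  (((l.foldl solveStep ((M, 0) : ℕ × ℤ)).2) % (M : ℤ)).toNat

/-- **The discrete logarithm read off a control read-out**: round the `2 · numTrials` phase
estimates to `s_t` and `c_t = a s_t mod M` (`M = p - 1`) and solve `s_t a ≡ c_t (mod M)`.
[cite: Kitaev1995, §1 p.5 and §4 p.15] -/
def dlogEst (M ℓ : ℕ) (γ : Fin (dlNumControls ℓ) → Bool) : ℕ :=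
  solveCongr M ((List.finRange numTrials).map fun t =>
    (roundMul M (dlPhaseEst ℓ γ t false), roundMul M (dlPhaseEst ℓ γ t true)))

/-! ### Correctness of rounding and of the congruence solver -/

/-- **Rounding recovers the numerator**: if `φ` is within `< 1/(2M)` of `v/M` modulo `1`, then
`roundMul M φ = v mod M`. [folklore] -/
theorem roundMul_eq_mod {M : ℕ} (hM : 0 < M) {φ : ℚ} {v : ℕ}
    (h : cdist φ ((v : ℚ) / M) < 1 / (2 * M)) : roundMul M φ = v % M := by
  obtain ⟨N, hN⟩ := exists_cdist_eq φ ((v : ℚ) / M)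
  rw [hN] at h
  have hMq : (0 : ℚ) < M := by exact_mod_cast hM
  have hround : round (φ * M) = (v : ℤ) + N * M := by
    rw [round_eq_iff, Set.mem_Ico]
    have h1 : |φ * M - (v + N * M)| < 1 / 2 := by
      have : φ * M - (v + N * M) = (φ - v / M - N) * M := by field_simp; ring
      rw [this, abs_mul, abs_of_pos hMq]
      calc |φ - v / M - N| * M < 1 / (2 * M) * M := mul_lt_mul_of_pos_right h hMq
        _ = 1 / 2 := by field_simp
    rw [abs_lt] at h1
    push_cast
    constructor <;> linarith [h1.1, h1.2]
  unfold roundMul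
  rw [hround, Int.add_mul_emod_self_right, ← Int.natCast_mod, Int.toNat_natCast]

/-- The first component of the fold is the iterated `gcd`. [folklore] -/
theorem foldl_solveStep_fst (l : List (ℕ × ℕ)) (acc : ℕ × ℤ) :
    (l.foldl solveStep acc).1 = l.foldl (fun g sc => Nat.gcd g sc.1) acc.1 := by
  induction l generalizing acc with
  | nil => rfl
  | cons sc l ih => rw [List.foldl_cons, List.foldl_cons, ih]; rfl

/-- The iterated `gcd` divides the start value and every first component, and is positive if
the start value is. [folklore] -/
theorem foldl_gcd_dvd (l : List (ℕ × ℕ)) (m₀ : ℕ) :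
    l.foldl (fun g sc => Nat.gcd g sc.1) m₀ ∣ m₀ ∧
      (∀ sc ∈ l, l.foldl (fun g sc => Nat.gcd g sc.1) m₀ ∣ sc.1) ∧
      (0 < m₀ → 0 < l.foldl (fun g sc => Nat.gcd g sc.1) m₀) := by
  induction l generalizing m₀ with
  | nil => simp
  | cons sc l ih =>
    obtain ⟨h1, h2, h3⟩ := ih (Nat.gcd m₀ sc.1)
    simp only [List.foldl_cons, List.mem_cons, forall_eq_or_imp]
    exact ⟨h1.trans (Nat.gcd_dvd_left _ _), ⟨h1.trans (Nat.gcd_dvd_right _ _), h2⟩,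
      fun hm => h3 (Nat.gcd_pos_of_pos_left _ hm)⟩

/-- **Invariant of the congruence solver**: if every pair `(s, c)` of `l` satisfies
`c ≡ s·a (mod M)` and the accumulator `(g, e)` satisfies `e ≡ g·a (mod M)`, then so does the
result of the fold. [folklore] -/
theorem foldl_solveStep_inv {M a : ℕ} (l : List (ℕ × ℕ))
    (hl : ∀ sc ∈ l, ((sc.2 : ℕ) : ℤ) ≡ (sc.1 : ℤ) * a [ZMOD M]) (acc : ℕ × ℤ)
    (hacc : acc.2 ≡ (acc.1 : ℤ) * a [ZMOD M]) :
    (l.foldl solveStep acc).2 ≡ ((l.foldl solveStep acc).1 : ℤ) * a [ZMOD M] := by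
  induction l generalizing acc with
  | nil => exact hacc
  | cons sc l ih =>
    rw [List.foldl_cons]
    refine ih (fun sc' h => hl sc' (List.mem_cons_of_mem _ h)) _ ?_
    have hsc := hl sc List.mem_cons_self
    show acc.2 * Nat.gcdA acc.1 sc.1 + sc.2 * Nat.gcdB acc.1 sc.1 ≡
      ((Nat.gcd acc.1 sc.1 : ℕ) : ℤ) * a [ZMOD M]
    rw [Nat.gcd_eq_gcd_ab, add_mul, mul_right_comm, mul_right_comm (sc.1 : ℤ)]
    exact (hacc.mul_right _).add (hsc.mul_right _)

/-- **Correctness of the congruence solver**: if `a < M`, every pair `(s, c)` of `l` satisfies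
`c ≡ s·a (mod M)`, and `gcd(M, s_1, …) = 1`, then `solveCongr M l = a`. [folklore] -/
theorem solveCongr_eq {M a : ℕ} (ha : a < M) {l : List (ℕ × ℕ)}
    (hl : ∀ sc ∈ l, ((sc.2 : ℕ) : ℤ) ≡ (sc.1 : ℤ) * a [ZMOD M])
    (hg : l.foldl (fun g sc => Nat.gcd g sc.1) M = 1) : solveCongr M l = a := by
  have hinv := foldl_solveStep_inv l hl (M, 0) (by
    show (0 : ℤ) ≡ (M : ℤ) * a [ZMOD M]
    unfold Int.ModEq
    rw [Int.mul_emod_right, Int.zero_emod])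
  rw [foldl_solveStep_fst, hg, Nat.cast_one, one_mul] at hinv
  unfold solveCongr
  rw [hinv.eq, ← Int.natCast_mod, Int.toNat_natCast, Nat.mod_eq_of_lt ha]

/-- **Good samples make the system solvable**: if the `s_t` have no common divisor `≥ 2` with
`M > 0`, the iterated `gcd` of `M` with `s_1, …, s_4` is `1`.
[cite: Kitaev1995, §4 (random elements generate H)] -/
theorem foldl_gcd_eq_one_of_good {M : ℕ} (hM : 0 < M) {s : Fin numTrials → Fin M}
    (hs : Good M s) (c : Fin numTrials → ℕ) :
    ((List.finRange numTrials).map fun t => ((s t : ℕ), c t)).foldl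
      (fun g sc => Nat.gcd g sc.1) M = 1 := by
  set l := (List.finRange numTrials).map fun t => ((s t : ℕ), c t) with hl
  obtain ⟨hdM, hds, hpos⟩ := foldl_gcd_dvd l M
  set G := l.foldl (fun g sc => Nat.gcd g sc.1) M with hG
  have hG0 : 0 < G := hpos hM
  by_contra hne
  obtain ⟨t, ht⟩ := hs G (by omega) hdM
  exact ht (hds ((s t : ℕ), c t) (List.mem_map.2 ⟨t, List.mem_finRange t, rfl⟩))

/-! ### The hidden law of the read-out: product weights indexed by `s ∈ (ℤ/M)^4` -/

/-- The weight of control `j` in the exponent: `2^{level j}` for a `g`-test, `a · 2^{level j}`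
for a `y`-test (`y ≡ g^a`). [cite: Kitaev1995, §4 (eigenvalues of V_1, V_2 on |ψ_h>)] -/
def dlW (ℓ a : ℕ) (j : Fin (dlNumControls ℓ)) : ℕ :=
  (if dlGenOf ℓ j then a else 1) * 2 ^ (dlLevelOf ℓ j : ℕ)

/-- The weight of outcome `b` of control `j` under the eigenvalue index `s ∈ (ℤ/M)^4`:
`(1 ± trig(2π s_{t(j)} w_j / M))/2`. [cite: Kitaev1995, §3 Remark 8] -/
def dlWeight (ℓ M a : ℕ) (s : Fin numTrials → Fin M) (j : Fin (dlNumControls ℓ)) (b : Bool) : ℝ :=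
  testWeight b (dlTypeOf ℓ j) (testAngleW M (dlTrialOf ℓ) (dlW ℓ a) s j)

/-- The success parameter of block `(t, η, l, σ)`: the weight of `1`. [folklore] -/
def dlBlockParam (ℓ M a : ℕ) (s : Fin numTrials → Fin M) (β : DlBlk ℓ) : ℝ :=
  testWeight true β.2.2.2
    (2 * π * ((s β.1 : ℕ) : ℝ) * (((if β.2.1 then a else 1) * 2 ^ (β.2.2.1 : ℕ) : ℕ) : ℝ) / M)

/-- On block `β` the weights of `1` are constant, equal to `dlBlockParam`. [folklore] -/
theorem dlWeight_true_of_mem_dlBlock {ℓ M a : ℕ} (s : Fin numTrials → Fin M) {β : DlBlk ℓ}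
    {j : Fin (dlNumControls ℓ)} (hj : j ∈ dlBlock ℓ β) :
    dlWeight ℓ M a s j true = dlBlockParam ℓ M a s β := by
  have h : dlBlkOf ℓ j = β := (mem_filter.1 hj).2
  subst h
  rfl

/-- The mean number of `1`s in a block is `B · p_β`. [folklore] -/
theorem sum_dlWeight_block {ℓ M a : ℕ} (s : Fin numTrials → Fin M) (β : DlBlk ℓ) :
    ∑ j ∈ dlBlock ℓ β, dlWeight ℓ M a s j true = dlBlockSize ℓ * dlBlockParam ℓ M a s β := by
  rw [sum_congr rfl fun j hj => dlWeight_true_of_mem_dlBlock s hj, sum_const, card_dlBlock,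
    nsmul_eq_mul]

/-- `DlAccurate s γ`: in every block the number of `1`s read is within `B/16` of its mean under
`s`. [cite: Kitaev1995, §3 (before Lemma 9)] -/
def DlAccurate (ℓ M a : ℕ) (s : Fin numTrials → Fin M) (γ : Fin (dlNumControls ℓ) → Bool) : Prop :=
  ∀ β : DlBlk ℓ, |(dlCnt β γ : ℝ) - ∑ j ∈ dlBlock ℓ β, dlWeight ℓ M a s j true| < dlBlockSize ℓ / 16

/-- The numerator of the phase tested by the `(t, η)`-blocks: `s_t` for `g` (`η = false`),
`a s_t` for `y` (`η = true`); the phase is `phaseNum / M` modulo `1`. [cite: Kitaev1995, §4] -/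
def phaseNum (a : ℕ) {M : ℕ} (s : Fin numTrials → Fin M) (t : Fin numTrials) (η : Bool) : ℕ :=
  (if η then a else 1) * (s t : ℕ)

/-! ### Correctness of the post-processing on accurate read-outs -/

/-- The block size is positive. [folklore] -/
theorem dlBlockSize_pos (ℓ : ℕ) : 0 < dlBlockSize ℓ := by
  unfold dlBlockSize dlNumLevels; omega

/-- `2^(dlNumLevels ℓ - 1) = 2^ℓ`. [folklore] -/
theorem two_pow_dlNumLevels_sub_one (ℓ : ℕ) : (2 : ℚ) ^ (dlNumLevels ℓ - 1) = 2 ^ ℓ := by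
  simp [dlNumLevels]

/-- **Accurate read-outs localise every level**:
`cdist (dlLevelEst γ t η l) (2^l · phaseNum / M) ≤ 5/32`. [cite: Kitaev1995, §3 Lemma 10] -/
theorem cdist_dlLevelEst_le {ℓ M a : ℕ} {s : Fin numTrials → Fin M}
    {γ : Fin (dlNumControls ℓ) → Bool} (hacc : DlAccurate ℓ M a s γ) (t : Fin numTrials) (η : Bool)
    (l : Fin (dlNumLevels ℓ)) :
    cdist (dlLevelEst ℓ γ t η l) (2 ^ (l : ℕ) * ((phaseNum a s t η : ℕ) : ℚ) / M) ≤ 5 / 32 := by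
  have hB := dlBlockSize_pos ℓ
  -- the two blocks of this trial, generator and level
  have hcos := hacc (t, η, l, false)
  have hsin := hacc (t, η, l, true)
  rw [sum_dlWeight_block] at hcos hsin
  simp only [dlBlockParam, testWeight, if_true, if_false, Bool.false_eq_true] at hcos hsin
  set θ : ℝ := 2 * π * ((s t : ℕ) : ℝ) * (((if η then a else 1) * 2 ^ (l : ℕ) : ℕ) : ℝ) / M with hθ
  obtain ⟨hc1, hc2⟩ := trigEst_of_cnt (c₀ := Real.cos θ) hB hcos
  obtain ⟨hs1, hs2⟩ := trigEst_of_cnt (c₀ := Real.sin θ) hB hsin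
  have hθ' : 2 * π * (((2 ^ (l : ℕ) * ((phaseNum a s t η : ℕ) : ℚ) / M : ℚ)) : ℝ) = θ := by
    rw [hθ]
    cases η <;>
      simp only [phaseNum, if_true, if_false, Bool.false_eq_true, one_mul] <;>
      push_cast <;> ring
  unfold dlLevelEst
  refine cdist_quadrantCenter_le_bool hc2 hs2 ?_ ?_
  · rw [hθ']; exact hc1
  · rw [hθ']; exact hs1

/-- **Accurate read-outs estimate every phase to within `(5/32)/2^ℓ`.**
[cite: Kitaev1995, §3 Lemma 10] -/
theorem cdist_dlPhaseEst_le {ℓ M a : ℕ} {s : Fin numTrials → Fin M}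
    {γ : Fin (dlNumControls ℓ) → Bool} (hacc : DlAccurate ℓ M a s γ) (t : Fin numTrials) (η : Bool) :
    cdist (dlPhaseEst ℓ γ t η) (((phaseNum a s t η : ℕ) : ℚ) / M) ≤ 5 / 32 / 2 ^ ℓ := by
  rw [dlPhaseEst, ← two_pow_dlNumLevels_sub_one]
  refine cdist_refined_le (by unfold dlNumLevels; omega) fun l hl => ?_
  rw [dif_pos hl, show (2 : ℚ) ^ l * (((phaseNum a s t η : ℕ) : ℚ) / M) =
    2 ^ l * ((phaseNum a s t η : ℕ) : ℚ) / M by ring]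
  exact cdist_dlLevelEst_le hacc t η ⟨l, hl⟩

/-- **Rounding an accurate estimate returns the exact numerator modulo `M`** (`M < 2^ℓ`, so the
precision `(5/32)/2^ℓ` is below `1/(2M)`). [cite: Kitaev1995, §3 Thm 1 (exact value from a sufficiently precise measurement)] -/
theorem roundMul_dlPhaseEst {ℓ M a : ℕ} (hM : 0 < M) (hMℓ : M < 2 ^ ℓ) {s : Fin numTrials → Fin M}
    {γ : Fin (dlNumControls ℓ) → Bool} (hacc : DlAccurate ℓ M a s γ) (t : Fin numTrials) (η : Bool) :
    roundMul M (dlPhaseEst ℓ γ t η) = phaseNum a s t η % M := by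
  refine roundMul_eq_mod hM (lt_of_le_of_lt (cdist_dlPhaseEst_le hacc t η) ?_)
  have hMq : (0 : ℚ) < M := by exact_mod_cast hM
  have h2 : (M : ℚ) < 2 ^ ℓ := by exact_mod_cast hMℓ
  rw [div_lt_div_iff₀ (by positivity) (by positivity)]
  linarith

/-- **Correctness of the post-processing** (Kitaev 1995, §3 Lemma 10 with §4 and §1 p. 5): on
an accurate read-out with good samples, `dlogEst` returns the discrete logarithm `a`.
[cite: Kitaev1995, §4 and §1 p.5] -/
theorem dlogEst_eq {ℓ M a : ℕ} (hM : 0 < M) (hMℓ : M < 2 ^ ℓ) (ha : a < M)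
    {s : Fin numTrials → Fin M} (hs : Good M s) {γ : Fin (dlNumControls ℓ) → Bool}
    (hacc : DlAccurate ℓ M a s γ) : dlogEst M ℓ γ = a := by
  unfold dlogEst
  have hround : ∀ t η, roundMul M (dlPhaseEst ℓ γ t η) = phaseNum a s t η % M :=
    fun t η => roundMul_dlPhaseEst hM hMℓ hacc t η
  simp_rw [hround]
  have h1 : ∀ t, phaseNum a s t false % M = (s t : ℕ) := fun t => by
    simp [phaseNum, Nat.mod_eq_of_lt (s t).isLt]
  simp_rw [h1]
  refine solveCongr_eq ha (fun sc hsc => ?_) (foldl_gcd_eq_one_of_good hM hs _)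
  obtain ⟨t, -, rfl⟩ := List.mem_map.1 hsc
  show (((phaseNum a s t true % M : ℕ) : ℤ)) % M = ((s t : ℕ) : ℤ) * a % M
  rw [Int.natCast_mod, Int.emod_emod_of_dvd _ (dvd_refl _)]
  simp only [phaseNum, if_true]
  push_cast
  ring_nf

/-! ### The weights are a product probability distribution; accurate read-outs are likely -/

/-- The weights of the experiment are nonnegative. [folklore] -/
theorem dlWeight_nonneg (ℓ M a : ℕ) (s : Fin numTrials → Fin M) (j : Fin (dlNumControls ℓ))
    (b : Bool) : 0 ≤ dlWeight ℓ M a s j b :=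
  testWeight_nonneg _ _ _

/-- The weights of the experiment are normalised. [folklore] -/
theorem dlWeight_false_add_true (ℓ M a : ℕ) (s : Fin numTrials → Fin M)
    (j : Fin (dlNumControls ℓ)) : dlWeight ℓ M a s j false + dlWeight ℓ M a s j true = 1 :=
  testWeight_false_add_true _ _

/-- The number of blocks is `16 · dlNumLevels ℓ`. [folklore] -/
theorem card_dlBlk (ℓ : ℕ) : Fintype.card (DlBlk ℓ) = 16 * dlNumLevels ℓ := by
  simp only [Fintype.card_prod, Fintype.card_fin, Fintype.card_bool]
  unfold numTrials
  ring

open scoped Classical in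
/-- **Inaccurate read-outs are rare**: under every `s` the read-outs that are not accurate have
total weight `≤ 1/12` (Chebyshev per block, `chebyshev_block`, and a union bound over the
`16 (ℓ+1)` blocks of size `12288 (ℓ+1)`). [cite: Kitaev1995, §3 (before Lemma 9)] -/
theorem sum_not_dlAccurate_le (ℓ M a : ℕ) (s : Fin numTrials → Fin M) :
    ∑ γ ∈ univ.filter (fun γ => ¬ DlAccurate ℓ M a s γ), ∏ j, dlWeight ℓ M a s j (γ j) ≤ 1 / 12 := by
  classical
  have hB := dlBlockSize_pos ℓ
  have hBr : (0 : ℝ) < dlBlockSize ℓ := by exact_mod_cast hB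
  -- `¬ DlAccurate` is a union over the blocks of large deviations
  have hsub : (univ.filter fun γ => ¬ DlAccurate ℓ M a s γ) =
      univ.filter fun γ : Fin (dlNumControls ℓ) → Bool => ∃ β : DlBlk ℓ,
        (dlBlockSize ℓ : ℝ) / 16 ≤ |(dlCnt β γ : ℝ) - ∑ j ∈ dlBlock ℓ β, dlWeight ℓ M a s j true| := by
    refine filter_congr fun γ _ => ?_
    simp only [DlAccurate, not_forall, not_lt]
  rw [hsub]
  refine (sum_filter_exists_le _ (fun γ => prod_nonneg fun j _ => dlWeight_nonneg ℓ M a s j _) _).trans ?_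
  have hblock : ∀ β : DlBlk ℓ, ∑ γ ∈ univ.filter (fun γ : Fin (dlNumControls ℓ) → Bool =>
      (dlBlockSize ℓ : ℝ) / 16 ≤ |(dlCnt β γ : ℝ) - ∑ j ∈ dlBlock ℓ β, dlWeight ℓ M a s j true|),
        ∏ j, dlWeight ℓ M a s j (γ j) ≤ 64 / dlBlockSize ℓ := by
    intro β
    have h := chebyshev_block (dlWeight ℓ M a s) (dlWeight_nonneg ℓ M a s)
      (dlWeight_false_add_true ℓ M a s) (dlBlock ℓ β) (a := (dlBlockSize ℓ : ℝ) / 16) (by positivity)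
    rw [card_dlBlock] at h
    refine (le_of_eq ?_).trans (h.trans (le_of_eq ?_))
    · rfl
    · field_simp
      ring
  calc ∑ β : DlBlk ℓ, ∑ γ ∈ univ.filter (fun γ : Fin (dlNumControls ℓ) → Bool =>
        (dlBlockSize ℓ : ℝ) / 16 ≤ |(dlCnt β γ : ℝ) - ∑ j ∈ dlBlock ℓ β, dlWeight ℓ M a s j true|),
          ∏ j, dlWeight ℓ M a s j (γ j)
      ≤ ∑ _β : DlBlk ℓ, (64 : ℝ) / dlBlockSize ℓ := sum_le_sum fun β _ => hblock β
    _ = (16 * dlNumLevels ℓ : ℕ) * ((64 : ℝ) / dlBlockSize ℓ) := by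
        rw [sum_const, card_univ, card_dlBlk, nsmul_eq_mul]
    _ = 1 / 12 := by
        have hL : (0 : ℝ) < dlNumLevels ℓ := by unfold dlNumLevels; positivity
        simp only [dlBlockSize, Nat.cast_mul, Nat.cast_ofNat]
        field_simp
        ring

open scoped Classical in
/-- **Accurate read-outs are likely**: total weight `≥ 11/12` under every `s`.
[cite: Kitaev1995, §3 (before Lemma 9)] -/
theorem sum_dlAccurate_ge (ℓ M a : ℕ) (s : Fin numTrials → Fin M) :
    11 / 12 ≤ ∑ γ ∈ univ.filter (fun γ => DlAccurate ℓ M a s γ), ∏ j, dlWeight ℓ M a s j (γ j) := by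
  classical
  have htot := sum_prodWeight (dlWeight ℓ M a s) (dlWeight_false_add_true ℓ M a s)
  rw [← sum_filter_add_sum_filter_not univ (fun γ => DlAccurate ℓ M a s γ)] at htot
  have := sum_not_dlAccurate_le ℓ M a s
  linarith

/-! ### The success probability of the experiment -/

section success

variable {ℓ m : ℕ}

/-- **Success bound for Kitaev's discrete-logarithm experiment.** For a classical block
computing `|x c 0⟩ ↦ |x c (R c)⟩` with `R` separating exactly the residues modulo `M` of the
weighted trial exponents `A_t(c) + a B_t(c)`, every set `E` of control read-outs containing all
accurate read-outs of all good samples has Born probability `≥ (7/8)(11/12) = 77/96`: the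
read-out law is the uniform mixture over `s ∈ (ℤ/M)^4` of product weights
(`kitaevCircuit_distributionW`), good `s` have mass `≥ 7/8` (`card_good_ge`) and accurate
read-outs mass `≥ 11/12` under each `s` (`sum_dlAccurate_ge`).
[cite: Kitaev1995, §3 (Lemma 10, Thm 1) and §4] -/
theorem dlog_success (V : QCircuit cliffordT (ℓ + (dlNumControls ℓ + m))) (x : QReg ℓ)
    (R : QReg (dlNumControls ℓ) → QReg m)
    (hV : ∀ y, V.toMatrix 0 *ᵥ basisState (coinInput x y) = basisState (tri x y (R y)))
    {M : ℕ} (a : ℕ) (hM : 0 < M)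
    (hR : ∀ y y', R y = R y' ↔ ∀ t, (M : ℤ) ∣
      (trialExpW (dlTrialOf ℓ) (dlW ℓ a) t y : ℤ) - (trialExpW (dlTrialOf ℓ) (dlW ℓ a) t y' : ℤ))
    (E : Finset (QReg (dlNumControls ℓ)))
    (hE : ∀ s : Fin numTrials → Fin M, Good M s → ∀ γ, DlAccurate ℓ M a s γ → γ ∈ E) :
    77 / 96 ≤ ∑ γ ∈ E, ∑ ρ : QReg m,
      ‖(kitaevCircuit V (dlTypeOf ℓ)).runOn 0 (basisState (padInput x (dlNumControls ℓ + m)))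
        (tri x γ ρ)‖ ^ 2 := by
  classical
  simp_rw [kitaevCircuit_distributionW V (dlTypeOf ℓ) x R hV hM (dlTrialOf ℓ) (dlW ℓ a) hR]
  rw [← mul_sum, Fintype.card_fin]
  change 77 / 96 ≤ 1 / (M : ℝ) ^ numTrials * ∑ γ ∈ E, ∑ s : Fin numTrials → Fin M,
    ∏ j, dlWeight ℓ M a s j (γ j)
  rw [sum_comm]
  have hrK : (0 : ℝ) < (M : ℝ) ^ numTrials := by positivity
  -- restrict to good samples, then to accurate read-outs
  have hW0 : ∀ (s : Fin numTrials → Fin M) (γ : Fin (dlNumControls ℓ) → Bool),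
      0 ≤ ∏ j, dlWeight ℓ M a s j (γ j) := fun s γ => prod_nonneg fun j _ => dlWeight_nonneg ℓ M a s j _
  have h1 : ∑ s ∈ univ.filter (fun s => Good M s), (11 / 12 : ℝ) ≤
      ∑ s : Fin numTrials → Fin M, ∑ γ ∈ E, ∏ j, dlWeight ℓ M a s j (γ j) := by
    calc ∑ s ∈ univ.filter (fun s => Good M s), (11 / 12 : ℝ)
        ≤ ∑ s ∈ univ.filter (fun s => Good M s), ∑ γ ∈ E, ∏ j, dlWeight ℓ M a s j (γ j) := by
          refine sum_le_sum fun s hs => ?_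
          have hs' : Good M s := (mem_filter.1 hs).2
          calc (11 / 12 : ℝ) ≤ ∑ γ ∈ univ.filter (fun γ => DlAccurate ℓ M a s γ),
              ∏ j, dlWeight ℓ M a s j (γ j) := sum_dlAccurate_ge ℓ M a s
            _ ≤ ∑ γ ∈ E, ∏ j, dlWeight ℓ M a s j (γ j) :=
                sum_le_sum_of_subset_of_nonneg (fun γ hγ => hE s hs' γ (mem_filter.1 hγ).2)
                  fun γ _ _ => hW0 s γ
      _ ≤ ∑ s : Fin numTrials → Fin M, ∑ γ ∈ E, ∏ j, dlWeight ℓ M a s j (γ j) :=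
          sum_le_sum_of_subset_of_nonneg (filter_subset _ _) fun s _ _ =>
            sum_nonneg fun γ _ => hW0 s γ
  rw [sum_const, nsmul_eq_mul] at h1
  have h2 := card_good_ge (r := M) hM
  have h3 : 7 / 8 * (M : ℝ) ^ numTrials * (11 / 12) ≤
      ∑ s : Fin numTrials → Fin M, ∑ γ ∈ E, ∏ j, dlWeight ℓ M a s j (γ j) :=
    le_trans (mul_le_mul_of_nonneg_right h2 (by norm_num)) h1
  calc (77 / 96 : ℝ) = 1 / (M : ℝ) ^ numTrials * (7 / 8 * (M : ℝ) ^ numTrials * (11 / 12)) := by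
        field_simp; ring
    _ ≤ 1 / (M : ℝ) ^ numTrials * ∑ s : Fin numTrials → Fin M, ∑ γ ∈ E, ∏ j, dlWeight ℓ M a s j (γ j) :=
        mul_le_mul_of_nonneg_left h3 (by positivity)

end success

/-! ### The family and its classical post-processor -/

/-- Kitaev's discrete-logarithm family: on inputs of length `ℓ`, Kitaev's circuit with
`dlNumControls ℓ` control wires laid out by `dlLayout ℓ` (sine tests marked by `dlTypeOf ℓ`)
around the classical block `V ℓ` using `mW ℓ` work wires. [cite: Kitaev1995, §3 (Remark 8, Lemma 10) and §4 p.15] -/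
def kitaevDLogFamily (mW : ℕ → ℕ) (V : (ℓ : ℕ) → QCircuit cliffordT (ℓ + (dlNumControls ℓ + mW ℓ))) :
    QCircuitFamily cliffordT :=
  ⟨fun ℓ => dlNumControls ℓ + mW ℓ, fun ℓ => kitaevCircuit (V ℓ) (dlTypeOf ℓ)⟩

/-- Kitaev's family is oracle-free if its blocks are. [folklore] -/
theorem kitaevDLogFamily_isOracleFree {mW : ℕ → ℕ}
    {V : (ℓ : ℕ) → QCircuit cliffordT (ℓ + (dlNumControls ℓ + mW ℓ))} (hV : ∀ ℓ, (V ℓ).IsOracleFree) :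
    (kitaevDLogFamily mW V).IsOracleFree := fun ℓ =>
  kitaevCircuit_isOracleFree (hV ℓ) _

/-- The control bits of a measured output string `y` of the family on an input of length `ℓ`
(wires `ℓ, …, ℓ + dlNumControls ℓ - 1`). [folklore] -/
def dlReadControls (ℓ : ℕ) (y : List Bool) : Fin (dlNumControls ℓ) → Bool :=
  fun j => y.getD (ℓ + j) false

/-- The Boolean pair encoding of discrete-logarithm instances `(p, (g, y))` used by
`encodeDLogInstance` (iterated `pairBool` of binary encodings). [cite: Shor1997, §6 (instances (p, g, x))] -/
abbrev dlogInstanceEncoding : Encoding (ℕ × ℕ × ℕ) Bool :=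
  encodingNatBool.pairBool (encodingNatBool.pairBool encodingNatBool)

/-- `encodeDLogInstance` is the encoder of `dlogInstanceEncoding` (definitional). [folklore] -/
theorem encodeDLogInstance_eq (p g y : ℕ) :
    encodeDLogInstance p g y = dlogInstanceEncoding.encode (p, g, y) := rfl

/-- **The classical post-processor of the discrete-logarithm family.** Input `⟨w, z⟩`: the
instance `w = ⟨p, ⟨g, y⟩⟩` and the measured output `z`; output the binary encoding of the
discrete logarithm read off the control bits of `z` (`dlogEst`: counts per block, quadrant
centres, halving refinement over `ℚ`, rounding to the nearest multiple of `1/(p-1)`, solution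
of the linear congruences by extended Euclid); `[]` if `w` is not a triple of numerals.
[cite: Kitaev1995, §1 p.5 and §4 p.15] -/
def dlogPost (z : List Bool) : List Bool :=
  match dlogInstanceEncoding.decode (boolUnpair z).1 with
  | none => []
  | some q => encodeNat (dlogEst (q.1 - 1) (boolUnpair z).1.length
      (dlReadControls (boolUnpair z).1.length (boolUnpair z).2))

/-- Reading the controls off the read-out of a label `x γ ρ` gives `γ`. [folklore] -/
theorem dlReadControls_ofFn_tri {ℓ m : ℕ} (x : QReg ℓ) (γ : Fin (dlNumControls ℓ) → Bool)
    (ρ : QReg m) : dlReadControls ℓ (List.ofFn (tri x γ ρ)) = γ := by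
  funext j
  have hj : ℓ + (j : ℕ) < ℓ + (dlNumControls ℓ + m) := by have := j.isLt; omega
  rw [dlReadControls, List.getD_eq_getElem?_getD, List.getElem?_ofFn]
  simp only [hj, dite_true, Option.getD_some]
  have : (⟨ℓ + (j : ℕ), hj⟩ : Fin (ℓ + (dlNumControls ℓ + m))) = coinWire ℓ (dlNumControls ℓ) m j :=
    Fin.ext (by rw [val_coinWire])
  rw [this, tri_coinWire]

/-- **The post-processor on the output of the family**: on `⟨⟨p, g, y⟩, read-out of x γ ρ⟩` it
returns the encoding of `dlogEst (p - 1) ℓ γ`. [folklore] -/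
theorem dlogPost_boolPair {m : ℕ} (p g y : ℕ)
    (γ : Fin (dlNumControls (encodeDLogInstance p g y).length) → Bool) (ρ : QReg m) :
    dlogPost (boolPair (encodeDLogInstance p g y)
      (List.ofFn (tri (encodeDLogInstance p g y).get γ ρ))) =
      encodeNat (dlogEst (p - 1) (encodeDLogInstance p g y).length γ) := by
  have hdec : dlogInstanceEncoding.decode (encodeDLogInstance p g y) = some (p, g, y) :=
    dlogInstanceEncoding.decode_encode (p, g, y)
  unfold dlogPost
  rw [boolUnpair_boolPair]
  simp only [hdec, dlReadControls_ofFn_tri]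

/-! ### Instances: the modulus, the discrete logarithm, the weighted exponents -/

/-- The weighted trial exponent splits as `A_t(c) + a · B_t(c)`: the `g`-controls of trial `t`
carry `A_t(c) = ∑ y_j 2^{l_j}`, the `y`-controls `B_t(c)`. [folklore] -/
theorem trialExpW_dlW (ℓ a : ℕ) (t : Fin numTrials) (c : QReg (dlNumControls ℓ)) :
    trialExpW (dlTrialOf ℓ) (dlW ℓ a) t c =
      trialExp (dlTag ℓ) (dlExps ℓ) (t, false) c + a * trialExp (dlTag ℓ) (dlExps ℓ) (t, true) c := by
  unfold trialExpW trialExp dlW dlTag dlExps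
  rw [sum_filter, sum_filter, sum_filter, mul_sum, ← sum_add_distrib]
  refine sum_congr rfl fun j _ => ?_
  by_cases ht : dlTrialOf ℓ j = t
  · cases hg : dlGenOf ℓ j
    · simp [ht]
    · simp [ht]
      ring
  · simp [ht]

/-- On an instance, products of powers of `g` and `y ≡ g^a` agree modulo `p` iff the weighted
exponents `A + a B` agree modulo `p - 1 = ord_p(g)` (Shor 1997, §6 p. 16: the third register `g^a x^{-b} ≡ g^k`
fixes `a - r b ≡ k (mod p-1)`). [cite: Shor1997, §6 p.16 (probability of observing |c, d, g^k>: sum over a - r b ≡ k)] -/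
theorem pow_mul_pow_modEq_iff {p g y a : ℕ} (h : IsDLogInstance p g y) (ha : a ∈ dlogSolutions p g y)
    (A B A' B' : ℕ) :
    g ^ A * y ^ B ≡ g ^ A' * y ^ B' [MOD p] ↔
      ((p - 1 : ℕ) : ℤ) ∣ ((A + a * B : ℕ) : ℤ) - ((A' + a * B' : ℕ) : ℤ) := by
  obtain ⟨hp, hg0, hgp, hord, hy0, hyp⟩ := h
  obtain ⟨-, hmod⟩ := (mem_dlogSolutions p g y a).1 ha
  have hy' : ∀ A B : ℕ, g ^ A * y ^ B ≡ g ^ (A + a * B) [MOD p] := fun A B => by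
    rw [pow_add, pow_mul]
    exact (hmod.symm.pow B).mul_left _
  have hfin : IsOfFinOrder (g : ZMod p) := orderOf_pos_iff.1 (by rw [hord]; have := hp.two_le; omega)
  constructor
  · intro hAB
    have h1 : g ^ (A + a * B) ≡ g ^ (A' + a * B') [MOD p] :=
      ((hy' A B).symm.trans hAB).trans (hy' A' B')
    rw [← ZMod.natCast_eq_natCast_iff, Nat.cast_pow, Nat.cast_pow, hfin.pow_eq_pow_iff_modEq, hord,
      Nat.modEq_iff_dvd] at h1
    rwa [dvd_sub_comm] at h1
  · intro hdvd
    have h1 : g ^ (A + a * B) ≡ g ^ (A' + a * B') [MOD p] := by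
      rw [← ZMod.natCast_eq_natCast_iff, Nat.cast_pow, Nat.cast_pow, hfin.pow_eq_pow_iff_modEq, hord,
        Nat.modEq_iff_dvd, dvd_sub_comm]
      exact hdvd
    exact ((hy' A B).trans h1).trans (hy' A' B').symm

/-- The modulus `p - 1` of an instance is below `2^ℓ` for the encoded length `ℓ`. [folklore] -/
theorem pred_lt_two_pow_length (p g y : ℕ) : p - 1 < 2 ^ (encodeDLogInstance p g y).length := by
  have h1 : p < 2 ^ (encodeNat p).length := by
    simpa using bitsToNat_lt (encodeNat p)
  have h2 : (encodeNat p).length ≤ (encodeDLogInstance p g y).length := by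
    have : (encodeDLogInstance p g y).length =
        2 * (encodeNat p).length + 2 + ((encodingNatBool.pairBool encodingNatBool).encode (g, y)).length :=
      length_boolPair _ _
    omega
  exact lt_of_le_of_lt (Nat.sub_le _ _) (lt_of_lt_of_le h1 (Nat.pow_le_pow_right (by norm_num) h2))

/-- The instance encoding is injective (curried form). [folklore] -/
theorem encodeDLogInstance_inj {p g y p' g' y' : ℕ}
    (h : encodeDLogInstance p g y = encodeDLogInstance p' g' y') : p = p' ∧ g = g' ∧ y = y' := by
  have := dlogInstanceEncoding.encode_injective h
  simpa using this

/-- **The on-promise bound.** On an instance `⟨p, g, y⟩` with discrete logarithm `a`, Kitaev's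
family with a correct block outputs, with probability `≥ 77/96`, a string on which the
post-processor returns the encoding of `a`. [cite: Kitaev1995, §3–§4] -/
theorem kernelProb_dlogPost_ge {mW : ℕ → ℕ}
    {V : (ℓ : ℕ) → QCircuit cliffordT (ℓ + (dlNumControls ℓ + mW ℓ))} (p g y : ℕ)
    (h : IsDLogInstance p g y) {a : ℕ} (ha : a ∈ dlogSolutions p g y)
    (R : QReg (dlNumControls (encodeDLogInstance p g y).length) →
      QReg (mW (encodeDLogInstance p g y).length))
    (hV : ∀ c, (V (encodeDLogInstance p g y).length).toMatrix 0 *ᵥ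
        basisState (coinInput (encodeDLogInstance p g y).get c) =
          basisState (tri (encodeDLogInstance p g y).get c (R c)))
    (hR : ∀ c c', R c = R c' ↔ ∀ t,
      g ^ trialExp (dlTag _) (dlExps _) (t, false) c * y ^ trialExp (dlTag _) (dlExps _) (t, true) c ≡
        g ^ trialExp (dlTag _) (dlExps _) (t, false) c' * y ^ trialExp (dlTag _) (dlExps _) (t, true) c'
          [MOD p]) :
    77 / 96 ≤ (kitaevDLogFamily mW V).kernelProb 0 (encodeDLogInstance p g y)
      {z | dlogPost (boolPair (encodeDLogInstance p g y) z) = encodeNat a} := by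
  classical
  set M := p - 1 with hM
  have hM0 : 0 < M := by have := h.1.two_le; omega
  have haM : a < M := ((mem_dlogSolutions p g y a).1 ha).1
  have hMℓ : M < 2 ^ (encodeDLogInstance p g y).length := pred_lt_two_pow_length p g y
  have hR' : ∀ c c', R c = R c' ↔ ∀ t, (M : ℤ) ∣
      (trialExpW (dlTrialOf (encodeDLogInstance p g y).length) (dlW _ a) t c : ℤ) -
        (trialExpW (dlTrialOf (encodeDLogInstance p g y).length) (dlW _ a) t c' : ℤ) := by
    intro c c'
    rw [hR]
    refine forall_congr' fun t => ?_
    rw [trialExpW_dlW, trialExpW_dlW]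
    exact pow_mul_pow_modEq_iff h ha _ _ _ _
  -- the favourable control read-outs: those on which `dlogEst` returns `a`
  have hE1 : ∀ s : Fin numTrials → Fin M, Good M s → ∀ γ,
      DlAccurate (encodeDLogInstance p g y).length M a s γ →
        γ ∈ univ.filter fun γ => dlogEst M (encodeDLogInstance p g y).length γ = a :=
    fun s hs γ hacc => mem_filter.2 ⟨mem_univ _, dlogEst_eq hM0 hMℓ haM hs hacc⟩
  have hE2 : ∀ γ ∈ univ.filter (fun γ => dlogEst M (encodeDLogInstance p g y).length γ = a),
      ∀ ρ : QReg (mW (encodeDLogInstance p g y).length),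
        List.ofFn (tri (encodeDLogInstance p g y).get γ ρ) ∈
          {z | dlogPost (boolPair (encodeDLogInstance p g y) z) = encodeNat a} := by
    intro γ hγ ρ
    rw [Set.mem_setOf_eq, dlogPost_boolPair, ← hM, (mem_filter.1 hγ).2]
  have hsucc := dlog_success (V _) (encodeDLogInstance p g y).get R hV a hM0 hR' _ hE1
  have hle := sum_tri_le_sum_ite
    ((kitaevCircuit (V _) (dlTypeOf _)).runOn 0
      (basisState (padInput (encodeDLogInstance p g y).get (dlNumControls _ + mW _))))
    (encodeDLogInstance p g y).get _ _ hE2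
  unfold QCircuitFamily.kernelProb QCircuitFamily.kernel
  change 77 / 96 ≤ ((((kitaevCircuit (V _) (dlTypeOf _)).outputPMF 0 (encodeDLogInstance p g y).get).map
    List.ofFn).toOuterMeasure _).toReal
  rw [toReal_outputPMF_map_toOuterMeasure]
  linarith

end Kitaev1995

/-! ### The named facts and the assembly of Shor's discrete-logarithm theorem -/

open _root_.Computability Complexity QuantumComplexity Matrix Finset Kitaev1995

/-- **Named fact: Kitaev's discrete-logarithm family with a clean double modular-exponentiation
block is poly-time uniform** (Shor 1997, §6, p. 16: "compute `g^a x^{-b} mod p` in the third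
register", by the reversible modular exponentiation of §3, p. 8: "we can compute any polynomial
time function `F(x)` as long as we keep the input `x` … copy it into a register that has been
preset to zero, and then undo the computation to erase both the first OUTPUT register and the
RECORD register"; Kitaev 1995, §2.2 Lemma 1 (garbage-free `(u, 0, 0) ↦ (u, F(u), 0)`), §4 p. 15
(`l` registers, measurements `Ξ(V_j^{2^s})` of both generators on each, "our procedure is
uniform … constructed in time `poly(k+n)` by a classical Turing machine"); exact Clifford+T
words for Toffoli by Nielsen–Chuang 2010, Fig. 4.9, cf. the tree's `revCompile`). Statement over
the tree's model, for the fixed layout `dlLayout ℓ` of this file: there are work-space bounds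
`mW ℓ` and oracle-free classical blocks `V ℓ` on `ℓ + dlNumControls ℓ + mW ℓ` wires such that the
Kitaev family around them (`kitaevDLogFamily`) is poly-time uniform, and on every instance
`w = ⟨p, g, y⟩` (`IsDLogInstance p g y`) the block maps each basis state `|w⟩|c⟩|0^{mW}⟩` to
`|w⟩|c⟩|R c⟩` where the work-register content `R c` determines and is determined by the residues
`g^{A_t(c)} y^{B_t(c)} mod p` of the four trials (`A_t`, `B_t` the exponents carried by the `g`-
and `y`-controls of trial `t`; it is the register holding these four modular products, computed
without garbage). This isolates the programming/uniformity part of the quantum half of Shor's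
discrete-logarithm theorem; the quantum analysis is proved in this file (`isQSolvable_dlog_of`).
[cite: Shor1997, §6 p.16 (third register g^a x^{-b} mod p) with §3 p.8 and §2 p.7 (uniformity); Kitaev1995, §2.2 Lemma 1 and §4 p.15] -/
def Kitaev1995_dlogFamily : Prop :=
  ∃ (mW : ℕ → ℕ) (V : (ℓ : ℕ) → QCircuit cliffordT (ℓ + (dlNumControls ℓ + mW ℓ))),
    (∀ ℓ, (V ℓ).IsOracleFree) ∧ (kitaevDLogFamily mW V).IsUniform ∧
    ∀ p g y : ℕ, IsDLogInstance p g y →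
      ∃ R : QReg (dlNumControls (encodeDLogInstance p g y).length) →
          QReg (mW (encodeDLogInstance p g y).length),
        (∀ c, (V (encodeDLogInstance p g y).length).toMatrix 0 *ᵥ
            basisState (coinInput (encodeDLogInstance p g y).get c) =
              basisState (tri (encodeDLogInstance p g y).get c (R c))) ∧
        (∀ c c', R c = R c' ↔ ∀ t,
          g ^ trialExp (dlTag _) (dlExps _) (t, false) c * y ^ trialExp (dlTag _) (dlExps _) (t, true) c ≡
            g ^ trialExp (dlTag _) (dlExps _) (t, false) c' *
              y ^ trialExp (dlTag _) (dlExps _) (t, true) c' [MOD p])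

/-- **Named programming fact: the post-processor is polynomial-time computable** (parse the
triple; for each of the `16 (ℓ+1)` blocks count the `1`s among `12288 (ℓ+1)` control bits; table
look-up of the quadrant centre; `ℓ` halving steps on rationals with denominator `2^{O(ℓ)}`, eight
times; eight roundings `round(φ (p-1)) mod (p-1)`; four extended-Euclid steps on numbers `< 2^ℓ`
(Knuth, TAOCP vol. 2, §4.5.2: `O(ℓ²)` bit operations each); binary encoding).
[cite: Kitaev1995, §3 Lemma 10 ("by a polynomial algorithm") and §4 p.15 ("processed in a classical way")] -/
def dlogPost_mem_FP : Prop :=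
  dlogPost ∈ FP

/-- **The quantum half of Shor's discrete-logarithm theorem, from the named facts.** Given the
uniform Kitaev family with its clean double-exponentiation block (`Kitaev1995_dlogFamily`), the
polynomial-time post-processor (`dlogPost_mem_FP`) and classical wrapping inside bounded-error
quantum search (`isQSolvable_classicalWrap`), the discrete logarithm problem is solvable in
bounded-error quantum polynomial time (`isQSolvable_dlog`, Shor 1997, §6): on an instance the
family's control read-out lands, with probability `≥ 77/96 > 2/3` (`dlog_success`), in the set of
read-outs on which the post-processor outputs the (unique, `existsUnique_mem_dlogSolutions_holds`)
discrete logarithm (`dlogEst_eq`); off the promise nothing is required.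
[cite: Shor1997, §6 (discrete logarithms in quantum polynomial time); Kitaev1995, §1 p.5, §3–§4] -/
theorem isQSolvable_dlog_of (hwrap : isQSolvable_classicalWrap)
    (hfam : Kitaev1995_dlogFamily) (hpost : dlogPost_mem_FP) : isQSolvable_dlog := by
  classical
  obtain ⟨mW, V, hVfree, hunif, hblock⟩ := hfam
  -- the raw relation solved by the family: "the post-processor outputs a discrete logarithm"
  let R₀ : List Bool → Set (List Bool) := fun w => {z | ∀ p g y : ℕ, w = encodeDLogInstance p g y →
    IsDLogInstance p g y → ∃ a ∈ dlogSolutions p g y, dlogPost (boolPair w z) = encodeNat a}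
  have h0 : IsQSolvable R₀ := by
    refine ⟨kitaevDLogFamily mW V, kitaevDLogFamily_isOracleFree hVfree, hunif, fun w => ?_⟩
    by_cases hw : ∃ p g y : ℕ, w = encodeDLogInstance p g y ∧ IsDLogInstance p g y
    · obtain ⟨p, g, y, rfl, hinst⟩ := hw
      obtain ⟨R, hV, hR⟩ := hblock p g y hinst
      obtain ⟨a, ha, huniq⟩ := existsUnique_mem_dlogSolutions_holds hinst
      have heq : R₀ (encodeDLogInstance p g y) =
          {z | dlogPost (boolPair (encodeDLogInstance p g y) z) = encodeNat a} := by
        ext z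
        simp only [Set.mem_setOf_eq, R₀]
        constructor
        · intro hz
          obtain ⟨a', ha', hz'⟩ := hz p g y rfl hinst
          rw [huniq a' ha'] at hz'
          exact hz'
        · intro hz p' g' y' hw' hinst'
          obtain ⟨rfl, rfl, rfl⟩ := encodeDLogInstance_inj hw'
          exact ⟨a, ha, hz⟩
      rw [heq]
      have := kernelProb_dlogPost_ge p g y hinst ha R hV hR
      linarith
    · have huniv : R₀ w = Set.univ := by
        ext z
        simp only [Set.mem_univ, iff_true, R₀, Set.mem_setOf_eq]
        intro p g y hw' hinst
        exact absurd ⟨p, g, y, hw', hinst⟩ hw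
      rw [huniv, kernelProb_univ]
      norm_num
  -- wrap with the post-processor
  have h1 := hwrap id dlogPost (PolyTimeComputable.id _) hpost h0
  refine h1.mono fun w z' hz' => ?_
  obtain ⟨z, hz, hpre⟩ := hz'
  intro p g y hw hinst
  obtain ⟨a, ha, hza⟩ := hz p g y hw hinst
  exact ⟨a, ha, hza ▸ hpre⟩

end Literature.Computability.Cryptography

end
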